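import Literature.RepresentationTheory.FiniteGroups.PiGroupCharacters
import Literature.RepresentationTheory.GeneralLinear.PlethysmWordModel
import HarnessLib

/-!
# The `K`-average skeleton for Ikenmeyer–Kandasamy 2020, Prop. 10.1 (bricks (B3)+(B4) assembled)

C. Ikenmeyer, U. Kandasamy, *Implementing geometric complexity theory: on the separation of orbit
closures via symmetries*, STOC 2020 = arXiv:1911.03990 [IkenmeyerKandasamy2019], §10, proof of
Prop. 10.1 ("`dim ({λ}^{Dϱ})^{stab ϱ} = ∑_{μ¹,…,μ^d} c^λ_{μ¹…μ^d} ∏ a_{μ^i}(ρ̂_i, iD)`"): after the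
word-model transport (the tree's `IK2020_prop_10_1_of_finrank_invariants_eq_bCoeff`,
`IK2020ContentSliceTransport.lean`) the left-hand side is `dim (HW_λ((ℂ^N)^{⊗dD}))^K` for the
wreath-type subgroup `K = K_{Dϱ}(w₀) ≅ ∏ᵢ 𝔖_{ρ̂ᵢ} ≀ 𝔖_{iD}` of a Young subgroup `∏ᵢ 𝔖_{nᵢ}`. This
theorem-only file supplies the three finite-group identities that turn that dimension into IK's
sum, for ANY family of subgroups `Kᵢ ≤ 𝔖_{nᵢ}` and ANY homomorphism `ψ : ∏ᵢ 𝔖_{nᵢ} → 𝔖_N`: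

* `card_mul_finrank_invariants_hwPermRep_eq_sum` — `|K| · dim (HW_μ)^K = ∑_{κ ∈ K} χ^μ(κ)`
  (Fulton–Harris (2.9) with Thm. 6.3 (2), the tree's `character_hwPermRep`);
* `sum_blockPerms_spechtCharacter_eq` — (B4) per block:
  `∑_{κ ∈ 𝔖_f ≀ 𝔖_M} χ^μ(κ) = |𝔖_f ≀ 𝔖_M| · a_μ(f, M)` (the plethysm coefficient
  `plethysmCoeffOfPartition`; the tree's `card_mul_finrank_wreathHW` +
  `plethysmCoeffOfPartition_eq_finrank_wreathHW`);
* `sum_pi_spechtCharacter_hom_eq` — (B3) summed: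
  `∑_{y ∈ ∏ Kᵢ} χ^λ(ψ y) = ∑_{μ•} ⟨χ^λ ∘ ψ, ⊠χ^{μ•}⟩ · ∏ᵢ ∑_{κ ∈ Kᵢ} χ^{μⁱ}(κ)`
  (`spechtCharacter_apply_hom_eq_sum`, `PiGroupCharacters.lean`).

What remains for Prop. 10.1 after this file (not done here): the identification of `K_{Dϱ}(w₀)` for a
block word `w₀` with `ψ(∏ᵢ 𝔖_{ρ̂ᵢ} ≀ 𝔖_{iD})`, the `Fin (dD) ≃ Fin (∑ nᵢ)` transport, and
`⟨χ^λ ∘ ψ, ⊠χ^{μ•}⟩ = c^λ_{μ•}` = the tree's `multiLRCoeff` (t01's `MultiYoungSymmetrizerRank`).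
No definitions, no named facts. Honest framing: finite-group bookkeeping for the `val-lit` cell
(row IK20); nothing here bears on VP versus VNP.

## References

* [IkenmeyerKandasamy2019] C. Ikenmeyer, U. Kandasamy, STOC 2020 / arXiv:1911.03990, §10 Prop. 10.1.
* [FultonHarrisGTM129] W. Fulton, J. Harris, GTM 129, §2.2 (2.9), Thm. 6.3 (2).
* [SerreLinearRepresentations1977] J.-P. Serre, GTM 42, §2.5 Thm. 6, §3.2 Thm. 10.
-/

noncomputable section

open scoped BigOperators
open Module
open Literature.NumberTheory.DiophantineGeometry
open Literature.RepresentationTheory.FiniteGroups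
open Literature.RepresentationTheory.GeneralLinear

namespace Literature.Computability.AlgebraicComplexity

/-! ### `|K| · dim (HW_μ)^K = ∑_{κ ∈ K} χ^μ(κ)` -/

section Invariants

variable (k : Type*) [Field k] [CharZero k] {N n : ℕ}

/-- **`|K| · dim (HW_μ((k^N)^{⊗n}))^K = ∑_{κ ∈ K} χ^μ(κ)`** for every subgroup `K ≤ 𝔖_n` and every
`μ ⊢ n` with at most `N` parts: `dim V^K = |K|⁻¹ ∑_K χ_V` (Fulton–Harris (2.9)) for the restriction
to `K` of the highest-weight representation `hwPermRep`, whose character is `χ^μ` (Thm. 6.3 (2),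
`character_hwPermRep`). [cite: FultonHarrisGTM129, §2.2 (2.9) and Thm. 6.3 (2)] -/
theorem card_mul_finrank_invariants_hwPermRep_eq_sum (K : Subgroup (Equiv.Perm (Fin n)))
    [Fintype K] (μ : Nat.Partition n) (hμ : μ.parts.card ≤ N) :
    (Nat.card K : k) * (Module.finrank k (Representation.invariants
        ((hwPermRep k (D := n) (Weight.ofPartition N μ)).comp K.subtype)) : k) =
      ∑ κ : K, spechtCharacter k μ (κ : Equiv.Perm (Fin n)) := by
  have hcard : (Nat.card K : k) ≠ 0 := Nat.cast_ne_zero.mpr Nat.card_pos.ne'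
  haveI : Invertible (Nat.card K : k) := invertibleOfNonzero hcard
  have h := Representation.card_inv_mul_sum_char_eq_finrank
    ((hwPermRep k (D := n) (Weight.ofPartition N μ)).comp K.subtype)
  rw [← h, ← mul_assoc, mul_inv_cancel₀ hcard, one_mul]
  refine Finset.sum_congr rfl fun κ _ => ?_
  rw [← character_hwPermRep k μ hμ]
  rfl

end Invariants

/-! ### (B4) per block: `∑_{κ ∈ 𝔖_f ≀ 𝔖_M} χ^μ(κ) = |𝔖_f ≀ 𝔖_M| · a_μ(f, M)` -/

section Block

variable (k : Type*) [Field k] [CharZero k] (N : ℕ) {f M : ℕ}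

/-- **`∑_{κ ∈ 𝔖_f ≀ 𝔖_M} χ^μ(κ) = |𝔖_f ≀ 𝔖_M| · a_μ(f, M)`**: the sum of a Specht character over
the wreath product `blockPerms f M ≤ 𝔖_{fM}` is its order times the plethysm coefficient
`a_μ(f, M) = mult_{μ^*} k[Sym^M k^N]_f` (`plethysmCoeffOfPartition k N M μ`), for `μ ⊢ fM` with at
most `N` parts and `M ≠ 0` — the invariant count `dim (HW_μ)^{𝔖_f ≀ 𝔖_M} = a_μ(f,M)`
(`card_mul_finrank_wreathHW` with the trivial twist, `plethysmCoeffOfPartition_eq_finrank_wreathHW`;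
IK §10: "`a_{μ^i}(ρ̂_i, iD)` … invariants under `𝔖_{ρ̂_i} ≀ 𝔖_{iD}`").
[cite: IkenmeyerKandasamy2019, §10 (proof of Prop. 10.1)] -/
theorem sum_blockPerms_spechtCharacter_eq (hM : M ≠ 0) (μ : Nat.Partition (f * M))
    (hμ : μ.parts.card ≤ N) :
    ∑ κ : ↥(blockPerms f M), spechtCharacter k μ (κ : Equiv.Perm (Fin (f * M))) =
      (Nat.card ↥(blockPerms f M) : k) * (plethysmCoeffOfPartition k N M μ : k) := by
  rw [plethysmCoeffOfPartition_eq_finrank_wreathHW k N hM μ hμ,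
    card_mul_finrank_wreathHW k N (1 : ↥(blockPerms f M) →* ℤˣ) μ hμ]
  refine Finset.sum_congr rfl fun κ _ => ?_
  rw [MonoidHom.one_apply, Units.val_one, Int.cast_one, one_mul]

end Block

/-! ### (B3) summed over `∏ Kᵢ`: the `K`-average skeleton -/

section Skeleton

variable {ι : Type} [Fintype ι] [DecidableEq ι] {n : ι → ℕ} {N : ℕ}

/-- **The `K`-average skeleton**: for subgroups `Kᵢ ≤ 𝔖_{nᵢ}`, a homomorphism
`ψ : ∏ᵢ 𝔖_{nᵢ} → 𝔖_N` and `λ ⊢ N`,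
`∑_{y ∈ ∏ Kᵢ} χ^λ(ψ y) = ∑_{μ•} ⟨χ^λ ∘ ψ, ⊠χ^{μ•}⟩ · ∏ᵢ ∑_{κ ∈ Kᵢ} χ^{μⁱ}(κ)` — expand `χ^λ ∘ ψ` in
the irreducible characters `⊠χ^{μ•}` of the Young subgroup (`spechtCharacter_apply_hom_eq_sum`)
and factor the sum over `∏ Kᵢ`. With `Kᵢ = 𝔖_{ρ̂ᵢ} ≀ 𝔖_{iD}`, `sum_blockPerms_spechtCharacter_eq`
and `card_mul_finrank_invariants_hwPermRep_eq_sum` this is the shape of IK's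
`dim ({λ}^{Dϱ})^{stab ϱ} = ∑_{μ•} c^λ_{μ•} ∏ᵢ a_{μ^i}(ρ̂_i, iD)`.
[cite: IkenmeyerKandasamy2019, §10 (proof of Prop. 10.1)] -/
theorem sum_pi_spechtCharacter_hom_eq (lam : Nat.Partition N)
    (ψ : (∀ i, Equiv.Perm (Fin (n i))) →* Equiv.Perm (Fin N))
    (K : ∀ i, Subgroup (Equiv.Perm (Fin (n i)))) [∀ i, Fintype ↥(K i)] :
    ∑ y : ∀ i, ↥(K i), spechtCharacter ℂ lam (ψ fun i => (y i : Equiv.Perm (Fin (n i)))) =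
      ∑ μ : ∀ i, Nat.Partition (n i),
        classInner (spechtCharacter ℂ lam ∘ ψ)
            (fun z : ∀ i, Equiv.Perm (Fin (n i)) => ∏ i, spechtCharacter ℂ (μ i) (z i)) *
          ∏ i, ∑ κ : ↥(K i), spechtCharacter ℂ (μ i) (κ : Equiv.Perm (Fin (n i))) := by
  have h : ∀ y : ∀ i, ↥(K i),
      spechtCharacter ℂ lam (ψ fun i => (y i : Equiv.Perm (Fin (n i)))) =
        ∑ μ : ∀ i, Nat.Partition (n i),
          classInner (spechtCharacter ℂ lam ∘ ψ)
              (fun z : ∀ i, Equiv.Perm (Fin (n i)) => ∏ i, spechtCharacter ℂ (μ i) (z i)) *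
            ∏ i, spechtCharacter ℂ (μ i) (y i : Equiv.Perm (Fin (n i))) :=
    fun y => spechtCharacter_apply_hom_eq_sum lam ψ _
  simp only [h]
  rw [Finset.sum_comm]
  refine Finset.sum_congr rfl fun μ _ => ?_
  rw [← Finset.mul_sum,
    Fintype.prod_sum fun i (κ : ↥(K i)) => spechtCharacter ℂ (μ i) (κ : Equiv.Perm (Fin (n i)))]

/-- **Corollary (the dimension form)**: if moreover `ψ` is injective with image `K ≤ 𝔖_N` and `λ`
has at most `N'` parts, then
`|K| · dim (HW_λ)^K = ∑_{μ•} ⟨χ^λ ∘ ψ, ⊠χ^{μ•}⟩ · ∏ᵢ ∑_{κ ∈ Kᵢ} χ^{μⁱ}(κ)`.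
[cite: IkenmeyerKandasamy2019, §10 (proof of Prop. 10.1)] -/
theorem card_mul_finrank_invariants_hwPermRep_eq_sum_pi {N' : ℕ} (lam : Nat.Partition N)
    (hlam : lam.parts.card ≤ N') (ψ : (∀ i, Equiv.Perm (Fin (n i))) →* Equiv.Perm (Fin N))
    (hψ : Function.Injective ψ) (K : ∀ i, Subgroup (Equiv.Perm (Fin (n i)))) [∀ i, Fintype ↥(K i)]
    (KN : Subgroup (Equiv.Perm (Fin N))) [Fintype KN]
    (hKN : KN = (Subgroup.pi Set.univ K).map ψ) :
    (Nat.card KN : ℂ) * (Module.finrank ℂ (Representation.invariants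
        ((hwPermRep ℂ (D := N) (Weight.ofPartition N' lam)).comp KN.subtype)) : ℂ) =
      ∑ μ : ∀ i, Nat.Partition (n i),
        classInner (spechtCharacter ℂ lam ∘ ψ)
            (fun z : ∀ i, Equiv.Perm (Fin (n i)) => ∏ i, spechtCharacter ℂ (μ i) (z i)) *
          ∏ i, ∑ κ : ↥(K i), spechtCharacter ℂ (μ i) (κ : Equiv.Perm (Fin (n i))) := by
  classical
  rw [card_mul_finrank_invariants_hwPermRep_eq_sum ℂ KN lam hlam, ← sum_pi_spechtCharacter_hom_eq]
  -- reindex the sum over `KN = ψ(∏ Kᵢ)` by `∏ Kᵢ`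
  subst hKN
  let e : (∀ i, ↥(K i)) → ↥((Subgroup.pi Set.univ K).map ψ) := fun y =>
    ⟨ψ fun i => (y i : Equiv.Perm (Fin (n i))),
      Subgroup.mem_map.mpr ⟨fun i => (y i : Equiv.Perm (Fin (n i))),
        fun i _ => (y i).2, rfl⟩⟩
  have he : Function.Bijective e := by
    constructor
    · intro y y' h
      have h' := hψ (congrArg Subtype.val h)
      funext i
      exact Subtype.ext (congr_fun h' i)
    · rintro ⟨τ, hτ⟩
      obtain ⟨x, hx, rfl⟩ := Subgroup.mem_map.mp hτ
      exact ⟨fun i => ⟨x i, hx i (Set.mem_univ i)⟩, rfl⟩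
  exact (Fintype.sum_bijective e he _ _ fun y => rfl).symm

end Skeleton

end Literature.Computability.AlgebraicComplexity

end
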